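import Summits.QuantumFields.QCD.Theorems.GaussianLinkFramesFrameFMClosurePlacementCollarAux1

/-!
# Crux `GaussianLinkFrames.FrameFMClosure` (stmt-QuantumFields-17375), line `pad-the-fibre`, stub
`stub_placementCollar` — helper 2: the touched set of the collar recipe of ONE point

Integer chart, notation of helper 1 (`Z` unfrozen block, `D` defects, `Q` region about the pad centre `b` of the
point `a`, frozen layers `(M, c)`, excluded coordinates `E`, free coordinate `d₀`).  `collar_touched`: the endpoints
of the links of `star(a) ∪ Q` are EXACTLY `Z ∪ D` — every unfrozen-block site carries a region link in direction
`d₀`, the star of `a` leaves the block only at the defects `a + s_k e_k` (`k ∈ E`), and the extra rungs end at the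
defects `ā + s_k e_k`.

References: placement recipe of the line card `pad-the-fibre` (triage r1-1 sharpen 1); elementary [folklore].
-/

noncomputable section

open scoped BigOperators
open Literature.Probability.LatticeModels

namespace Summit.QuantumFields.QCD.Theorems.PadTheFibreCollar

/-- **The touched set of `star(a) ∪ Q` is `Z ∪ D`.** [folklore] -/
theorem collar_touched (ℓ : ℕ) (a b c : Site 4) (M E : Finset (Fin 4))
    (Z D : Finset (Site 4)) (Q : Finset (Site 4 × Fin 4))
    (hZ : ∀ y : Site 4, y ∈ Z ↔ (∀ i, -2 ≤ y i - b i ∧ y i - b i ≤ 1) ∧ ∀ k ∈ E, y k - b k ≠ c k)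
    (hD : ∀ y : Site 4, y ∈ D ↔ ∃ k ∈ E,
        y = a + Pi.single k (if c k = 1 then (1 : ℤ) else -1) ∨
        y = (if (a 0 - (ℓ : ℤ)) % 2 = 0 then a - Pi.single 0 1 else a + Pi.single 0 1) +
              Pi.single k (if c k = 1 then (1 : ℤ) else -1))
    (hQ : ∀ q : Site 4 × Fin 4, q ∈ Q ↔
        (q.1 ∈ Z ∧ q.1 + Pi.single q.2 1 ∈ Z ∧
          ¬ ((∃ k ∈ M, q.1 k - b k = c k) ∧ (∃ k ∈ M, (q.1 + Pi.single q.2 1 : Site 4) k - b k = c k))) ∨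
        ∃ k ∈ E, q = (if c k = 1 then
            ((if (a 0 - (ℓ : ℤ)) % 2 = 0 then a - Pi.single 0 1 else a + Pi.single 0 1), k)
          else ((if (a 0 - (ℓ : ℤ)) % 2 = 0 then a - Pi.single 0 1 else a + Pi.single 0 1) - Pi.single k 1, k)))
    (hcore : ∀ i, a i - b i = 0 ∨ a i - b i = -1) (hpar : (b 0 - (ℓ : ℤ)) % 2 = 0)
    (hc : ∀ k ∈ M, c k = -2 ∨ c k = 1) (hEM : E ⊆ M) (d₀ : Fin 4) (hd₀ : d₀ ∉ E)
    (hME : ∀ k ∈ M, k ∈ E ∨ k = d₀)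
    (hadj : ∀ k ∈ E, (c k = 1 → a k - b k = 0) ∧ (c k = -2 → a k - b k = -1)) (y : Site 4) :
    (y ∈ Z ∨ y ∈ D) ↔
      ((y = a ∨ ∃ μ : Fin 4, y = a + Pi.single μ 1 ∨ y = a - Pi.single μ 1) ∨
        ∃ q ∈ Q, q.1 = y ∨ q.1 + Pi.single q.2 1 = y) := by
  obtain ⟨hā, hāa⟩ := collar_abar_core ℓ a b hcore hpar
  set ā : Site 4 := (if (a 0 - (ℓ : ℤ)) % 2 = 0 then a - Pi.single 0 1 else a + Pi.single 0 1) with hādef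
  -- the two core sites lie in the unfrozen block
  have coreZ : ∀ z : Site 4, (∀ i, z i - b i = 0 ∨ z i - b i = -1) → z ∈ Z := by
    intro z hz
    refine (hZ z).2 ⟨fun i => by rcases hz i with h | h <;> omega, fun k hk h => ?_⟩
    rcases hc k (hEM hk) with h' | h' <;> rcases hz k with h'' | h'' <;> omega
  have haZ : a ∈ Z := coreZ a hcore
  have hāZ : ā ∈ Z := coreZ ā hā
  constructor
  · rintro (hy | hy)
    · -- an unfrozen-block site carries a region link in direction `d₀`
      obtain ⟨hy1, hy2⟩ := (hZ y).1 hy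
      right
      have hdk : ∀ k ∈ E, k ≠ d₀ := fun k hk h => hd₀ (h ▸ hk)
      by_cases hyd : y d₀ - b d₀ ≤ 0
      · refine ⟨(y, d₀), (hQ _).2 (Or.inl ⟨hy, (hZ _).2 ⟨fun i => ?_, fun k hk => ?_⟩, ?_⟩), Or.inl rfl⟩
        · by_cases hi : i = d₀
          · subst hi; simp; constructor <;> linarith [(hy1 i).1]
          · simpa [hi] using hy1 i
        · simp [hdk k hk]; exact hy2 k hk
        · rintro ⟨⟨k, hk, h1⟩, ⟨k', hk', h2⟩⟩
          rcases hME k hk with h | rfl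
          · exact hy2 k h h1
          · rcases hME k' hk' with h' | rfl
            · exact hy2 k' h' (by simpa [hdk k' h'] using h2)
            · simp only [Pi.add_apply, Pi.single_eq_same] at h1 h2; omega
      · refine ⟨(y - Pi.single d₀ 1, d₀), (hQ _).2 (Or.inl ⟨(hZ _).2 ⟨fun i => ?_, fun k hk => ?_⟩,
          by simpa using hy, ?_⟩), Or.inr (by simp)⟩
        · by_cases hi : i = d₀
          · subst hi; simp; constructor <;> linarith [(hy1 i).2]
          · simpa [hi] using hy1 i
        · simp [hdk k hk]; exact hy2 k hk
        · rintro ⟨⟨k, hk, h1⟩, ⟨k', hk', h2⟩⟩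
          rcases hME k' hk' with h' | rfl
          · exact hy2 k' h' (by simpa using h2)
          · rcases hME k hk with h | rfl
            · exact hy2 k h (by simpa [hdk k h] using h1)
            · simp only [Pi.add_apply, Pi.sub_apply, Pi.single_eq_same] at h1 h2; omega
    · obtain ⟨k, hk, h | h⟩ := (hD y).1 hy
      · -- a star defect
        left; right
        refine ⟨k, ?_⟩
        by_cases hck : c k = 1
        · left; simpa [hck] using h
        · right; rw [h, sub_eq_add_neg, ← Pi.single_neg]; simp [hck]
      · -- a rung defect
        right
        refine ⟨_, (hQ _).2 (Or.inr ⟨k, hk, rfl⟩), ?_⟩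
        by_cases hck : c k = 1
        · right; simp only [hck, if_true] at h ⊢; exact h.symm
        · left; simp only [hck, if_false] at h ⊢; rw [h, sub_eq_add_neg, ← Pi.single_neg]
  · rintro ((rfl | ⟨μ, rfl | rfl⟩) | ⟨q, hq, h⟩)
    · exact Or.inl haZ
    · by_cases hμ : μ ∈ E ∧ c μ = 1
      · exact Or.inr ((hD _).2 ⟨μ, hμ.1, Or.inl (by simp [hμ.2])⟩)
      · refine Or.inl ((hZ _).2 ⟨fun i => ?_, fun k hk hk' => ?_⟩)
        · by_cases hi : i = μ
          · subst hi; rcases hcore i with h | h <;> simp <;> omega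
          · rcases hcore i with h | h <;> simp [hi] <;> omega
        · by_cases hkμ : k = μ
          · subst hkμ
            simp at hk'
            rcases hc k (hEM hk) with h | h
            · rcases hcore k with h' | h' <;> omega
            · exact hμ ⟨hk, h⟩
          · simp [hkμ] at hk'
            rcases hc k (hEM hk) with h | h <;> rcases hcore k with h' | h' <;> omega
    · by_cases hμ : μ ∈ E ∧ c μ = -2
      · refine Or.inr ((hD _).2 ⟨μ, hμ.1, Or.inl ?_⟩)
        rw [sub_eq_add_neg, ← Pi.single_neg]; simp [hμ.2]
      · refine Or.inl ((hZ _).2 ⟨fun i => ?_, fun k hk hk' => ?_⟩)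
        · by_cases hi : i = μ
          · subst hi; rcases hcore i with h | h <;> simp <;> omega
          · rcases hcore i with h | h <;> simp [hi] <;> omega
        · by_cases hkμ : k = μ
          · subst hkμ
            simp at hk'
            rcases hc k (hEM hk) with h | h
            · exact hμ ⟨hk, h⟩
            · rcases hcore k with h' | h' <;> omega
          · simp [hkμ] at hk'
            rcases hc k (hEM hk) with h | h <;> rcases hcore k with h' | h' <;> omega
    · rw [hQ] at hq
      rcases hq with ⟨h1, h2, -⟩ | ⟨k, hk, rfl⟩
      · rcases h with rfl | rfl
        · exact Or.inl h1
        · exact Or.inl h2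
      · by_cases hck : c k = 1
        · simp only [hck, if_true] at h
          rcases h with rfl | rfl
          · exact Or.inl hāZ
          · exact Or.inr ((hD _).2 ⟨k, hk, Or.inr (by simp [hck])⟩)
        · simp only [hck, if_false] at h
          rcases h with rfl | rfl
          · refine Or.inr ((hD _).2 ⟨k, hk, Or.inr ?_⟩)
            rw [sub_eq_add_neg, ← Pi.single_neg]; simp [hck]
          · rw [sub_add_cancel]; exact Or.inl hāZ

/-- **The aligned `0`-flip preserves the unfrozen block**: `τ y = y + e₀` if `y₀ ≡ ℓ (mod 2)`, else `y - e₀`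
(the pad centre has `b₀ ≡ ℓ`, and `0` is not an excluded coordinate). [folklore] -/
theorem collar_flip_Z (ℓ : ℕ) (b c : Site 4) (E : Finset (Fin 4)) (Z : Finset (Site 4))
    (hZ : ∀ y : Site 4, y ∈ Z ↔ (∀ i, -2 ≤ y i - b i ∧ y i - b i ≤ 1) ∧ ∀ k ∈ E, y k - b k ≠ c k)
    (hpar : (b 0 - (ℓ : ℤ)) % 2 = 0) (h0E : (0 : Fin 4) ∉ E) (y : Site 4) (hy : y ∈ Z) :
    (if (y 0 - (ℓ : ℤ)) % 2 = 0 then y + Pi.single 0 1 else y - Pi.single 0 1) ∈ Z := by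
  obtain ⟨hy1, hy2⟩ := (hZ y).1 hy
  have hk0 : ∀ k ∈ E, k ≠ 0 := fun k hk h => h0E (h ▸ hk)
  have h0 := hy1 0
  split_ifs with h
  · refine (hZ _).2 ⟨fun i => ?_, fun k hk => by simpa [hk0 k hk] using hy2 k hk⟩
    by_cases hi : i = 0
    · subst hi; simp; omega
    · simpa [hi] using hy1 i
  · refine (hZ _).2 ⟨fun i => ?_, fun k hk => by simpa [hk0 k hk] using hy2 k hk⟩
    by_cases hi : i = 0
    · subst hi; simp; omega
    · simpa [hi] using hy1 i

/-- **The complementary `0`-flip preserves the defects**: `τ' y = y - e₀` if `y₀ ≡ ℓ (mod 2)`, else `y + e₀`, swaps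
`a + s_k e_k` and `ā + s_k e_k`. [folklore] -/
theorem collar_flip_D (ℓ : ℕ) (a c : Site 4) (E : Finset (Fin 4)) (D : Finset (Site 4))
    (hD : ∀ y : Site 4, y ∈ D ↔ ∃ k ∈ E,
        y = a + Pi.single k (if c k = 1 then (1 : ℤ) else -1) ∨
        y = (if (a 0 - (ℓ : ℤ)) % 2 = 0 then a - Pi.single 0 1 else a + Pi.single 0 1) +
              Pi.single k (if c k = 1 then (1 : ℤ) else -1))
    (h0E : (0 : Fin 4) ∉ E) (y : Site 4) (hy : y ∈ D) :
    (if (y 0 - (ℓ : ℤ)) % 2 = 0 then y - Pi.single 0 1 else y + Pi.single 0 1) ∈ D := by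
  have hk0 : ∀ k ∈ E, k ≠ 0 := fun k hk h => h0E (h ▸ hk)
  obtain ⟨k, hk, h | h⟩ := (hD y).1 hy
  · refine (hD _).2 ⟨k, hk, Or.inr ?_⟩
    have hy0 : y 0 = a 0 := by rw [h]; simp [(hk0 k hk).symm]
    rw [hy0]
    generalize (Pi.single k (if c k = 1 then (1 : ℤ) else -1) : Site 4) = v at h ⊢
    subst h
    by_cases ha : (a 0 - (ℓ : ℤ)) % 2 = 0
    · rw [if_pos ha, if_pos ha]; abel
    · rw [if_neg ha, if_neg ha]; abel
  · refine (hD _).2 ⟨k, hk, Or.inl ?_⟩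
    by_cases ha : (a 0 - (ℓ : ℤ)) % 2 = 0
    · rw [if_pos ha] at h
      have hy0 : y 0 = a 0 - 1 := by rw [h]; simp [(hk0 k hk).symm]
      rw [if_neg (by rw [hy0]; omega)]
      generalize (Pi.single k (if c k = 1 then (1 : ℤ) else -1) : Site 4) = v at h ⊢
      subst h
      abel
    · rw [if_neg ha] at h
      have hy0 : y 0 = a 0 + 1 := by rw [h]; simp [(hk0 k hk).symm]
      rw [if_pos (by rw [hy0]; omega)]
      generalize (Pi.single k (if c k = 1 then (1 : ℤ) else -1) : Site 4) = v at h ⊢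
      subst h
      abel

/-- Both `0`-flips (`τ`: `+e₀` on `y₀ ≡ ℓ`, `-e₀` otherwise; `τ'`: the other way round) are involutions moving
every site to a `0`-neighbour. [folklore] -/
theorem collar_flips_invol (ℓ : ℕ) (τ τ' : Site 4 → Site 4)
    (hτ : ∀ y, τ y = if (y 0 - (ℓ : ℤ)) % 2 = 0 then y + Pi.single 0 1 else y - Pi.single 0 1)
    (hτ' : ∀ y, τ' y = if (y 0 - (ℓ : ℤ)) % 2 = 0 then y - Pi.single 0 1 else y + Pi.single 0 1)
    (y : Site 4) :
    (τ (τ y) = y ∧ (τ y = y + Pi.single 0 1 ∨ y = τ y + Pi.single 0 1)) ∧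
    (τ' (τ' y) = y ∧ (τ' y = y + Pi.single 0 1 ∨ y = τ' y + Pi.single 0 1)) := by
  constructor
  · by_cases h : (y 0 - (ℓ : ℤ)) % 2 = 0
    · have h' : ¬ ((y + Pi.single 0 1 : Site 4) 0 - (ℓ : ℤ)) % 2 = 0 := by simp; omega
      rw [hτ y, if_pos h, hτ, if_neg h']
      exact ⟨by simp, Or.inl rfl⟩
    · have h' : ((y - Pi.single 0 1 : Site 4) 0 - (ℓ : ℤ)) % 2 = 0 := by simp; omega
      rw [hτ y, if_neg h, hτ, if_pos h']
      exact ⟨by simp, Or.inr (by simp)⟩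
  · by_cases h : (y 0 - (ℓ : ℤ)) % 2 = 0
    · have h' : ¬ ((y - Pi.single 0 1 : Site 4) 0 - (ℓ : ℤ)) % 2 = 0 := by simp; omega
      rw [hτ' y, if_pos h, hτ', if_neg h']
      exact ⟨by simp, Or.inr (by simp)⟩
    · have h' : ((y + Pi.single 0 1 : Site 4) 0 - (ℓ : ℤ)) % 2 = 0 := by simp; omega
      rw [hτ' y, if_neg h, hτ', if_pos h']
      exact ⟨by simp, Or.inl rfl⟩

/-- **Location of the touched set.**  Unfrozen-block sites lie inside `Λ̂` in every coordinate `≠ 0`; defects lie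
outside `Λ̂` in some coordinate `≠ 0` (so the blocks and the defects of two points never meet); everything lies in
the window `[-3ℓ-4, 3ℓ+3]⁴`. [folklore] -/
theorem collar_location (ℓ : ℕ) (a b c : Site 4) (M E : Finset (Fin 4)) (Z D : Finset (Site 4))
    (hZ : ∀ y : Site 4, y ∈ Z ↔ (∀ i, -2 ≤ y i - b i ∧ y i - b i ≤ 1) ∧ ∀ k ∈ E, y k - b k ≠ c k)
    (hD : ∀ y : Site 4, y ∈ D ↔ ∃ k ∈ E,
        y = a + Pi.single k (if c k = 1 then (1 : ℤ) else -1) ∨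
        y = (if (a 0 - (ℓ : ℤ)) % 2 = 0 then a - Pi.single 0 1 else a + Pi.single 0 1) +
              Pi.single k (if c k = 1 then (1 : ℤ) else -1))
    (hcore : ∀ i, a i - b i = 0 ∨ a i - b i = -1) (hpar : (b 0 - (ℓ : ℤ)) % 2 = 0)
    (hc : ∀ k ∈ M, c k = -2 ∨ c k = 1) (hEM : E ⊆ M) (h0E : (0 : Fin 4) ∉ E)
    (hΛ : ∀ w : Site 4, (∀ i, -2 ≤ w i ∧ w i ≤ 1) → ∀ k : Fin 4,
      (b k + w k < -(3 * (ℓ : ℤ) + 3) ∨ 3 * (ℓ : ℤ) + 2 < b k + w k) → (k ∈ E ∨ k = 0) ∧ k ∈ M ∧ w k = c k)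
    (hDout : ∀ k ∈ E, (c k = 1 → a k = 3 * ℓ + 2) ∧ (c k = -2 → a k = -(3 * (ℓ : ℤ) + 3)))
    (hb : ∀ i, -(3 * (ℓ : ℤ) + 2) ≤ b i ∧ b i ≤ 3 * ℓ + 2)
    (haΛ : ∀ i, -(3 * (ℓ : ℤ) + 3) ≤ a i ∧ a i ≤ 3 * ℓ + 2) :
    (∀ y ∈ Z, ∀ k : Fin 4, k ≠ 0 → -(3 * (ℓ : ℤ) + 3) ≤ y k ∧ y k ≤ 3 * ℓ + 2) ∧
    (∀ y ∈ D, ∃ k : Fin 4, k ≠ 0 ∧ (y k < -(3 * (ℓ : ℤ) + 3) ∨ 3 * (ℓ : ℤ) + 2 < y k)) ∧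
    (∀ y : Site 4, y ∈ Z ∨ y ∈ D → ∀ i, -(3 * (ℓ : ℤ) + 4) ≤ y i ∧ y i ≤ 3 * ℓ + 3) := by
  obtain ⟨hā, hāa⟩ := collar_abar_core ℓ a b hcore hpar
  have hk0 : ∀ k ∈ E, k ≠ 0 := fun k hk h => h0E (h ▸ hk)
  refine ⟨fun y hy k hk => ?_, fun y hy => ?_, fun y hy i => ?_⟩
  · obtain ⟨hy1, hy2⟩ := (hZ y).1 hy
    by_contra h
    have h' := hΛ (y - b) (fun i => by simpa using hy1 i) k (by simp only [Pi.sub_apply]; omega)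
    rcases h'.1 with h1 | h1
    · exact hy2 k h1 (by simpa using h'.2.2)
    · exact hk h1
  · obtain ⟨k, hk, h⟩ := (hD y).1 hy
    refine ⟨k, hk0 k hk, ?_⟩
    have hyk : y k = a k + (if c k = 1 then (1 : ℤ) else -1) := by
      rcases h with rfl | rfl
      · simp
      · rw [Pi.add_apply, hāa k (hk0 k hk)]; simp
    rw [hyk]
    rcases hc k (hEM hk) with h' | h'
    · have := (hDout k hk).2 h'; rw [if_neg (by omega)]; omega
    · have := (hDout k hk).1 h'; rw [if_pos h']; omega
  · rcases hy with hy | hy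
    · have := ((hZ y).1 hy).1 i; have := hb i; omega
    · obtain ⟨k, hk, h⟩ := (hD y).1 hy
      have hs : (if c k = 1 then (1 : ℤ) else -1) = 1 ∨ (if c k = 1 then (1 : ℤ) else -1) = -1 := by
        split_ifs <;> simp
      have := haΛ i; have := hb i; have := hā i
      rcases h with rfl | rfl
      · by_cases hik : i = k
        · subst hik; rcases hs with hs | hs <;> simp [hs] <;> omega
        · simp [hik]; omega
      · by_cases hik : i = k
        · subst hik; rcases hs with hs | hs <;> simp only [Pi.add_apply, hs, Pi.single_eq_same] <;> omega
        · simp only [Pi.add_apply, Pi.single_eq_of_ne hik, add_zero]; omega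

/-- **Registered helper `stub_placementCollar_aux2` of crux stmt-QuantumFields-17375** (line `pad-the-fibre`, stub
`stub_placementCollar`): the endpoints of `star(a) ∪ Q` are exactly `Z ∪ D` (integer chart) — one line (`collar_touched`). [folklore] -/
theorem stub_placementCollar_aux2 : ∀ (ℓ : ℕ) (a b c : Site 4) (M E : Finset (Fin 4)) (Z D : Finset (Site 4)) (Q : Finset (Site 4 × Fin 4)) (_ : ∀ y : Site 4, y ∈ Z ↔ (∀ i, -2 ≤ y i - b i ∧ y i - b i ≤ 1) ∧ ∀ k ∈ E, y k - b k ≠ c k) (_ : ∀ y : Site 4, y ∈ D ↔ ∃ k ∈ E, y = a + Pi.single k (if c k = 1 then (1 : ℤ) else -1) ∨ y = (if (a 0 - (ℓ : ℤ)) % 2 = 0 then a - Pi.single 0 1 else a + Pi.single 0 1) + Pi.single k (if c k = 1 then (1 : ℤ) else -1)) (_ : ∀ q : Site 4 × Fin 4, q ∈ Q ↔ (q.1 ∈ Z ∧ q.1 + Pi.single q.2 1 ∈ Z ∧ ¬ ((∃ k ∈ M, q.1 k - b k = c k) ∧ (∃ k ∈ M, (q.1 + Pi.single q.2 1 : Site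 4) k - b k = c k))) ∨ ∃ k ∈ E, q = (if c k = 1 then ((if (a 0 - (ℓ : ℤ)) % 2 = 0 then a - Pi.single 0 1 else a + Pi.single 0 1), k) else ((if (a 0 - (ℓ : ℤ)) % 2 = 0 then a - Pi.single 0 1 else a + Pi.single 0 1) - Pi.single k 1, k))) (_ : ∀ i, a i - b i = 0 ∨ a i - b i = -1) (_ : (b 0 - (ℓ : ℤ)) % 2 = 0) (_ : ∀ k ∈ M, c k = -2 ∨ c k = 1) (_ : E ⊆ M) (d₀ : Fin 4) (_ : d₀ ∉ E) (_ : ∀ k ∈ M, k ∈ E ∨ k = d₀) (_ : ∀ k ∈ E, (c k = 1 → a k - b k = 0) ∧ (c k = -2 → a k - b k = -1)) (y : Site 4), (y ∈ Z ∨ y ∈ D) ↔ ((y = a ∨ ∃ μ : Fin 4, y = a + Pi.single μ 1 ∨ y = a - Pi.single μ 1) ∨ ∃ q ∈ Q, q.1 = y ∨ q.1 + Pi.single q.2 1 = y) :=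
  collar_touched

end Summit.QuantumFields.QCD.Theorems.PadTheFibreCollar

end
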